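import Summits.QuantumAdvantage.QuantumAdvantage.Theorems.CubicForrelationNearExactIsExactCubicFormCellLT

/-!
# Crux `CubicForrelation.NearExactIsExact` (stmt-QuantumAdvantage-14043) — CELL LEMMA L-T in MATRIX FORM: the `F`-rows of the
  second-derivative matrix of a light `T`-cell have rank `≤ 1` (weight `< 160`) or `≤ 2` (weight `< 192`)

Certificate seat `b2b-cforr-cert` (gen 41).  HONEST FRAMING: kernel-checked linear algebra over `𝔽₂` (standard axioms) converting the
output of `tlt_T_cell_types` (…CubicFormCellLT) into the format of the R2 leaves `tpa_R2_Ta/Tb` (…TwelvePartnerR2LeafTa/Tb: `G_{F,·} = g νᵀ`,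
`Γ_{F,·} = m μᵀ + m′ μ′ᵀ`).  For `f` on `3 + 6` bits with the cubic form of `y₀y₁y₂` let `Q := f ⊕ y₀y₁y₂` and
`A(j,k) := Q(0) ⊕ Q(e_k) ⊕ Q(e_j) ⊕ Q(e_j ⊕ e_k)` (`9 × 9`, symmetric).  Then `64 ≤ wt f`; `wt f < 128 ⇒ A(3+i, s) = 0`;
  `wt f < 160 ⇒ A(3+i, s) = g(i) ν(s)`;  `wt f < 192 ⇒` that, or `A(3+i, s) = m(i) μ(s) ⊕ m′(i) μ′(s)`.
Key step (`tlt_functional_span`): an additive functional vanishing on the radical of a form with a maximal frame `(b₀, c₀)` of size one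
is `λ = λ(c₀)·B(·,b₀) ⊕ λ(b₀)·B(·,c₀)`.  Nothing about `θ₁₂`; NOT summit progress.

* `tlt_functional_span`, `tlt_T_cell_matrix`.

References: HOME/b2b-cforr-cert-g39/E1280-HANDPROOFS.md App. A.3 and §1.1.  Axioms: the standard three.
-/

set_option linter.dupNamespace false -- D-0017: single-problem summit ⇒ `QuantumAdvantage.QuantumAdvantage` by design

namespace Summit.QuantumAdvantage.QuantumAdvantage.Theorems.CubicForrelation.NearExactIsExact

open Finset
open Literature.Computability.QuantumComplexity.BuzetChailloux (bxor zeroVec allOnes bxor_comm bxor_self bxor_zeroVec zeroVec_bxor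
  bxor_bxor_cancel_left)

/-- **Functionals vanishing on the radical of a rank-two form.**  `B` symmetric, additive, alternating with a maximal frame `(b₀, c₀)`;
an additive `λ` with `λ|_{Rad B} = 0` equals `λ(c₀)·B(·, b₀) ⊕ λ(b₀)·B(·, c₀)`. [folklore] -/
theorem tlt_functional_span {n : ℕ} (B : (Fin n → Bool) → (Fin n → Bool) → Bool) (hsymm : ∀ x y, B x y = B y x)
    (hadd : ∀ x y z, B (bxor x y) z = (B x z ^^ B y z)) (halt : ∀ x, B x x = false)
    (b₀ c₀ : Fin n → Bool) (hbc : B b₀ c₀ = true)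
    (hmax : ∀ x y, B x b₀ = false → B x c₀ = false → B y b₀ = false → B y c₀ = false → B x y = false)
    (lam : (Fin n → Bool) → Bool) (hlam : ∀ x y, lam (bxor x y) = (lam x ^^ lam y)) (hrad : ∀ r, (∀ y, B r y = false) → lam r = false)
    (x : Fin n → Bool) : lam x = ((B x b₀ && lam c₀) ^^ (B x c₀ && lam b₀)) := by
  have hcb : B c₀ b₀ = true := by rw [hsymm]; exact hbc
  -- reduction of a vector to the frame-orthogonal set
  have hred : ∀ y, ∃ y', B y' b₀ = false ∧ B y' c₀ = false ∧
      (∀ z, B y z = ((B y' z ^^ (B y b₀ && B c₀ z)) ^^ (B y c₀ && B b₀ z))) ∧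
      lam y = ((lam y' ^^ (B y b₀ && lam c₀)) ^^ (B y c₀ && lam b₀)) := by
    intro y
    cases hb : B y b₀ <;> cases hc : B y c₀
    · exact ⟨y, hb, hc, fun z => by simp, by simp⟩
    · refine ⟨bxor y b₀, ?_, ?_, fun z => ?_, ?_⟩
      · rw [hadd, hb, halt]; rfl
      · rw [hadd, hc, hbc]; rfl
      · rw [hadd]; cases B y z <;> cases B b₀ z <;> rfl
      · rw [hlam]; cases lam y <;> cases lam b₀ <;> rfl
    · refine ⟨bxor y c₀, ?_, ?_, fun z => ?_, ?_⟩
      · rw [hadd, hb, hcb]; rfl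
      · rw [hadd, hc, halt]; rfl
      · rw [hadd]; cases B y z <;> cases B c₀ z <;> rfl
      · rw [hlam]; cases lam y <;> cases lam c₀ <;> rfl
    · refine ⟨bxor y (bxor c₀ b₀), ?_, ?_, fun z => ?_, ?_⟩
      · rw [hadd, hadd, hb, hcb, halt]; rfl
      · rw [hadd, hadd, hc, halt, hbc]; rfl
      · rw [hadd, hadd]; cases B y z <;> cases B c₀ z <;> cases B b₀ z <;> rfl
      · rw [hlam, hlam]; cases lam y <;> cases lam b₀ <;> cases lam c₀ <;> rfl
  obtain ⟨x', h1, h2, -, h4⟩ := hred x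
  -- `x'` is in the radical
  have hx' : ∀ z, B x' z = false := by
    intro z
    obtain ⟨z', k1, k2, k3, -⟩ := hred z
    rw [hsymm, k3 x', hsymm z' x', hmax x' z' h1 h2 k1 k2, hsymm c₀ x', h2, hsymm b₀ x', h1]
    cases B z b₀ <;> cases B z c₀ <;> rfl
  rw [h4, hrad x' hx']
  cases B x b₀ <;> cases B x c₀ <;> cases lam c₀ <;> cases lam b₀ <;> rfl

/-- **Cell lemma L-T, matrix form.**  See the module docstring. [this work; E1280-HANDPROOFS App. A.3, §1.1] -/
theorem tlt_T_cell_matrix (f : (Fin (3 + 6) → Bool) → Bool)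
    (hT : ∀ u v w x : Fin (3 + 6) → Bool,
      (((f x ^^ f (bxor x w)) ^^ (f (bxor x v) ^^ f (bxor (bxor x v) w))) ^^
          ((f (bxor x u) ^^ f (bxor (bxor x u) w)) ^^ (f (bxor (bxor x u) v) ^^ f (bxor (bxor (bxor x u) v) w)))) =
        ((((u (Fin.castAdd 6 0) && (v (Fin.castAdd 6 1) && w (Fin.castAdd 6 2))) ^^
              (u (Fin.castAdd 6 0) && (v (Fin.castAdd 6 2) && w (Fin.castAdd 6 1)))) ^^
            ((u (Fin.castAdd 6 1) && (v (Fin.castAdd 6 0) && w (Fin.castAdd 6 2))) ^^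
              (u (Fin.castAdd 6 1) && (v (Fin.castAdd 6 2) && w (Fin.castAdd 6 0))))) ^^
          ((u (Fin.castAdd 6 2) && (v (Fin.castAdd 6 0) && w (Fin.castAdd 6 1))) ^^
            (u (Fin.castAdd 6 2) && (v (Fin.castAdd 6 1) && w (Fin.castAdd 6 0)))))) :
    let Q : (Fin (3 + 6) → Bool) → Bool := fun z => f z ^^ ((z (Fin.castAdd 6 0) && z (Fin.castAdd 6 1)) && z (Fin.castAdd 6 2))
    let A : Fin (3 + 6) → Fin (3 + 6) → Bool := fun j k =>
      (Q zeroVec ^^ Q (fun l => decide (l = k))) ^^ (Q (fun l => decide (l = j)) ^^ Q (bxor (fun l => decide (l = j)) (fun l => decide (l = k))))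
    64 ≤ #(univ.filter fun y : Fin (3 + 6) → Bool => f y = true) ∧
    (#(univ.filter fun y : Fin (3 + 6) → Bool => f y = true) < 128 → ∀ i s, A (Fin.natAdd 3 i) s = false) ∧
    (#(univ.filter fun y : Fin (3 + 6) → Bool => f y = true) < 160 →
      ∃ (g : Fin 6 → Bool) (ν : Fin (3 + 6) → Bool), ∀ i s, A (Fin.natAdd 3 i) s = (g i && ν s)) ∧
    (#(univ.filter fun y : Fin (3 + 6) → Bool => f y = true) < 192 →
      (∃ (g : Fin 6 → Bool) (ν : Fin (3 + 6) → Bool), ∀ i s, A (Fin.natAdd 3 i) s = (g i && ν s)) ∨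
      (∃ (m m' : Fin 6 → Bool) (μ μ' : Fin (3 + 6) → Bool), ∀ i s, A (Fin.natAdd 3 i) s = ((m i && μ s) ^^ (m' i && μ' s)))) := by
  classical
  intro Q A
  set Qf : (Fin 3 → Bool) → (Fin 6 → Bool) → Bool := fun t s =>
    f (Fin.append t s) ^^ (((Fin.append t s) (Fin.castAdd 6 0) && (Fin.append t s) (Fin.castAdd 6 1)) && (Fin.append t s) (Fin.castAdd 6 2))
    with hQf
  set B : (Fin 6 → Bool) → (Fin 6 → Bool) → Bool := fun v w =>
    (Qf zeroVec zeroVec ^^ Qf zeroVec w) ^^ (Qf zeroVec v ^^ Qf zeroVec (bxor v w)) with hBdef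
  set βUF : (Fin 3 → Bool) → (Fin 6 → Bool) → Bool := fun a x => (Qf a x ^^ Qf a zeroVec) ^^ (Qf zeroVec x ^^ Qf zeroVec zeroVec)
    with hβdef
  have hLT : 64 ≤ #(univ.filter fun y : Fin (3 + 6) → Bool => f y = true) ∧
    (#(univ.filter fun y : Fin (3 + 6) → Bool => f y = true) < 128 → (∀ v w, B v w = false) ∧ ∀ a x, βUF a x = false) ∧
    (#(univ.filter fun y : Fin (3 + 6) → Bool => f y = true) < 160 →
      (∀ v w, B v w = false) ∧ ∃ m : (Fin 6 → Bool) → Bool, ∀ a, (∀ x, βUF a x = false) ∨ (∀ x, βUF a x = m x)) ∧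
    (#(univ.filter fun y : Fin (3 + 6) → Bool => f y = true) < 192 →
      ((∀ v w, B v w = false) ∧ ∃ m : (Fin 6 → Bool) → Bool, ∀ a, (∀ x, βUF a x = false) ∨ (∀ x, βUF a x = m x)) ∨
      (∃ b₀ c₀ : Fin 6 → Bool, B b₀ c₀ = true ∧
        (∀ x y, B x b₀ = false → B x c₀ = false → B y b₀ = false → B y c₀ = false → B x y = false) ∧
        ∀ (t : Fin 3 → Bool) (r : Fin 6 → Bool), (∀ y, B r y = false) → Qf t r = Qf t zeroVec)) := tlt_T_cell_types f hT
  have hBall : ∀ (t : Fin 3 → Bool) (v w x : Fin 6 → Bool),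
      ((Qf t x ^^ Qf t (bxor x w)) ^^ (Qf t (bxor x v) ^^ Qf t (bxor (bxor x v) w))) = B v w :=
    fun t v w x => tlt_second_const f hT t v w x
  obtain ⟨hsymm, hadd, halt, -⟩ := tcb_form_basic (fun s => Qf zeroVec s) B (hBall zeroVec)
  -- `βUF` is additive in `x`
  have hβx : ∀ a x y, βUF a (bxor x y) = (βUF a x ^^ βUF a y) := by
    intro a x y
    have e1 := hBall a x y zeroVec
    have e2 := hBall zeroVec x y zeroVec
    simp only [zeroVec_bxor] at e1 e2
    simp only [hβdef]
    rw [← e2] at e1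
    revert e1
    generalize Qf a zeroVec = A₁; generalize Qf a y = A₂; generalize Qf a x = A₃; generalize Qf a (bxor x y) = A₄
    generalize Qf zeroVec zeroVec = A₅; generalize Qf zeroVec y = A₆; generalize Qf zeroVec x = A₇
    generalize Qf zeroVec (bxor x y) = A₈
    revert A₁ A₂ A₃ A₄ A₅ A₆ A₇ A₈; decide
  -- unit vectors in the coordinates `(t, s)`
  have hunit : ∀ s : Fin (3 + 6), (fun l : Fin (3 + 6) => decide (l = s)) =
      Fin.append (fun j : Fin 3 => decide (Fin.castAdd 6 j = s)) (fun l : Fin 6 => decide (Fin.natAdd 3 l = s)) := by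
    intro s
    funext l
    refine Fin.addCases (fun j => ?_) (fun k => ?_) l
    · simp only [Fin.append_left]
    · simp only [Fin.append_right]
  have hQQf : ∀ t x, Q (Fin.append t x) = Qf t x := fun _ _ => rfl
  -- the `F`-rows of `A` in terms of `B` and `βUF`
  have hA : ∀ (i : Fin 6) (s : Fin (3 + 6)), A (Fin.natAdd 3 i) s =
      (B (fun l : Fin 6 => decide (Fin.natAdd 3 l = s)) (fun l => decide (l = i)) ^^
        βUF (fun j : Fin 3 => decide (Fin.castAdd 6 j = s)) (fun l => decide (l = i))) := by
    intro i s
    have e1 := hBall (fun j : Fin 3 => decide (Fin.castAdd 6 j = s)) (fun l : Fin 6 => decide (Fin.natAdd 3 l = s))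
      (fun l => decide (l = i)) zeroVec
    simp only [zeroVec_bxor] at e1
    simp only [A, hβdef]
    rw [tcc_unit_right i, hunit s, tcc_append_bxor, zeroVec_bxor, ← tcc_append_zero, hQQf, hQQf, hQQf, hQQf,
      bxor_comm (fun l : Fin 6 => decide (l = i))]
    revert e1
    generalize Qf (fun j : Fin 3 => decide (Fin.castAdd 6 j = s)) zeroVec = A₁
    generalize Qf (fun j : Fin 3 => decide (Fin.castAdd 6 j = s)) (fun l => decide (l = i)) = A₂
    generalize Qf (fun j : Fin 3 => decide (Fin.castAdd 6 j = s)) (fun l : Fin 6 => decide (Fin.natAdd 3 l = s)) = A₃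
    generalize Qf (fun j : Fin 3 => decide (Fin.castAdd 6 j = s))
      (bxor (fun l : Fin 6 => decide (Fin.natAdd 3 l = s)) (fun l => decide (l = i))) = A₄
    generalize Qf zeroVec zeroVec = A₅; generalize Qf zeroVec (fun l => decide (l = i)) = A₆
    generalize B (fun l : Fin 6 => decide (Fin.natAdd 3 l = s)) (fun l => decide (l = i)) = A₇
    revert A₁ A₂ A₃ A₄ A₅ A₆ A₇; decide
  -- type `(0,0)` / `(0,1)`: rank `≤ 1`
  have hrank1 : ((∀ v w, B v w = false) ∧ ∃ m : (Fin 6 → Bool) → Bool, ∀ a, (∀ x, βUF a x = false) ∨ (∀ x, βUF a x = m x)) →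
      ∃ (g : Fin 6 → Bool) (ν : Fin (3 + 6) → Bool), ∀ i s, A (Fin.natAdd 3 i) s = (g i && ν s) := by
    rintro ⟨hB0, m, hm⟩
    refine ⟨fun i => m (fun l => decide (l = i)),
      fun s => if (∀ x, βUF (fun j : Fin 3 => decide (Fin.castAdd 6 j = s)) x = false) then false else true, fun i s => ?_⟩
    rw [hA, hB0, Bool.false_xor]
    dsimp only
    by_cases hz : ∀ x, βUF (fun j : Fin 3 => decide (Fin.castAdd 6 j = s)) x = false
    · rw [if_pos hz, hz, Bool.and_false]
    · rw [if_neg hz, Bool.and_true]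
      rcases hm (fun j : Fin 3 => decide (Fin.castAdd 6 j = s)) with h0 | h1
      · exact absurd h0 hz
      · exact h1 _
  refine ⟨hLT.1, fun hlt i s => ?_, fun hlt => hrank1 (hLT.2.2.1 hlt), fun hlt => ?_⟩
  · obtain ⟨hB0, hβ0⟩ := hLT.2.1 hlt
    rw [hA, hB0, hβ0]; rfl
  rcases hLT.2.2.2 hlt with h01 | ⟨b₀, c₀, hbc, hmax, hconst⟩
  · exact Or.inl (hrank1 h01)
  · -- type `(1,0)`: rank `≤ 2`
    right
    have hβrad : ∀ a r, (∀ y, B r y = false) → βUF a r = false := by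
      intro a r hr
      simp only [hβdef]
      rw [hconst a r hr, hconst zeroVec r hr]
      cases Qf a zeroVec <;> cases Qf zeroVec zeroVec <;> rfl
    refine ⟨fun i => B (fun l => decide (l = i)) b₀, fun i => B (fun l => decide (l = i)) c₀,
      fun s => (B c₀ (fun l : Fin 6 => decide (Fin.natAdd 3 l = s)) ^^ βUF (fun j : Fin 3 => decide (Fin.castAdd 6 j = s)) c₀),
      fun s => (B b₀ (fun l : Fin 6 => decide (Fin.natAdd 3 l = s)) ^^ βUF (fun j : Fin 3 => decide (Fin.castAdd 6 j = s)) b₀),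
      fun i s => ?_⟩
    have F1 := tlt_functional_span B hsymm hadd halt b₀ c₀ hbc hmax (fun y => B y (fun l : Fin 6 => decide (Fin.natAdd 3 l = s)))
      (fun x y => hadd x y _) (fun r hr => hr _) (fun l => decide (l = i))
    have F2 := tlt_functional_span B hsymm hadd halt b₀ c₀ hbc hmax (fun y => βUF (fun j : Fin 3 => decide (Fin.castAdd 6 j = s)) y)
      (fun x y => hβx _ x y) (fun r hr => hβrad _ r hr) (fun l => decide (l = i))
    rw [hA, hsymm _ (fun l => decide (l = i)), F1, F2]
    dsimp only
    generalize B (fun l => decide (l = i)) b₀ = A₁; generalize B (fun l => decide (l = i)) c₀ = A₂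
    generalize B c₀ (fun l : Fin 6 => decide (Fin.natAdd 3 l = s)) = A₃
    generalize B b₀ (fun l : Fin 6 => decide (Fin.natAdd 3 l = s)) = A₄
    generalize βUF (fun j : Fin 3 => decide (Fin.castAdd 6 j = s)) c₀ = A₅
    generalize βUF (fun j : Fin 3 => decide (Fin.castAdd 6 j = s)) b₀ = A₆
    revert A₁ A₂ A₃ A₄ A₅ A₆; decide

end Summit.QuantumAdvantage.QuantumAdvantage.Theorems.CubicForrelation.NearExactIsExact
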